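import Summits.BirchSwinnertonDyer.BirchSwinnertonDyer.Theorems.AlignedTransportAtTwoMainConjectureOfRankZeroBSDAtTwoFineRoadRealKummerCoefficients
import Summits.BirchSwinnertonDyer.BirchSwinnertonDyer.Theorems.AlignedTransportAtTwoMainConjectureOfRankZeroBSDAtTwoFineRoadLocalAway
import Summits.BirchSwinnertonDyer.BirchSwinnertonDyer.Theorems.AlignedTransportAtTwoMainConjectureOfRankZeroBSDAtTwoFineRoadLocalArch
import Summits.BirchSwinnertonDyer.BirchSwinnertonDyer.Theorems.AlignedTransportAtTwoMainConjectureOfRankZeroBSDAtTwoSeedTwoTorsion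
import HarnessLib

/-!
# The CLASSICAL twin: `Sel_{p^∞}(E/K_∞)[p]` finite (= `X(E/K_∞)` torsion with `μ = 0`, stub T's conclusion) read on `E[p]` with
# HONEST local conditions away from `p` — inside `ι_*⁻¹(Sel_{p^∞}(E/K_∞))` the classes LOCALLY TRIVIAL at every finite `v ∤ p`
# have FINITE INDEX; over `ℚ`, `p = 2`, `Δ_E > 0`: locally trivial at odd places, Kummer at `2` (pulled back), Kummer LINE at `∞`

Cell `bsd-f1-sign2`, WIDTH-5 attach seat `bsd-line-att-p5` (gen 10) on line `birth` of crux C2 stmt-BirchSwinnertonDyer-22298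
`MainConjectureOfRankZeroBSDAtTwo`; sequel of `…FineRoadRealKummerCoefficients` (the FINE twin, att-p5 g10) and of att-p3 g7's
`…SeedTwoTorsion` (T ⟺ «`Sel_{2^∞}(W/ℚ_∞)[2]` finite» ⟺ «`ι_*⁻¹(Sel_{2^∞})` finite»). A `--supports 22298 --as helper` file.
HONEST FRAMING: THEOREMS ONLY — no definition, no named fact, no `sorry`; C2-NEUTRAL (stub T stays OPEN; the verdict
«blocked-on GreenbergMuConjectureIrreducible» is untouched); BSD is NOT proved by any of this.

WHAT. `H = Gal(K̄/K_∞)` (cyclotomic `ℤ_p`-extension of a number field `K`), `ι_* : H¹(H, E[p]) → H¹(H, E[p^∞])`,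
`P := ι_*⁻¹(Sel_{p^∞}(E/K_∞))` (the CLASSICAL Selmer group `WeierstrassCurve.selmerInfty`, Kummer conditions at every place);
§1 `finite_pTorsion_iff_finite_comap` (any subgroup of `H¹(H, E[p^∞])`): `Sel_{p^∞}(E/K_∞)[p]` finite ⟺ `P` finite.
`Q := P ⊓ A`, `A` = «`conj_σ y` restricts to ZERO on `H ⊓ D_v` for every finite `v ∤ p` and every `σ`» (the `E[p]`-level
`awayKer`s). By att-p4 g3 (`LocalAway.localKerOver_eq_awayKer`: over `K_∞` the classical condition at `v ∤ p` IS «locally trivial»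
on `E[p^∞]`) the finite-place analysis of the fine twin applies verbatim AWAY FROM `p`:
* §1 **`relIndex_comap_selmerInfty_inf_away_ne_zero`: `[P : Q] < ∞`** (any `K`, any `p`, cyclotomic `κ`; representatives for the
  finitely many places above each bad `v ∤ p`, finite local kernels, vanishing at good `v ∤ p`; the conditions above `p` and at `∞`
  are the same on both sides); `finite_pTorsion_selmerInfty_iff_finite_comap_inf_away` (`Sel_{p^∞}(E/K_∞)[p]` finite ⟺ `Q` finite);
  with att-p3 g7: ⟺ `X(E/K_∞)` is `Λ`-torsion with `μ = 0` for every dual datum (`isTorsion_and_mu_eq_zero_iff_finite_comap_inf_away`).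
* §2 (`ℚ`, `2`, `Δ_E > 0`, cyclotomic): **`exists_kummerLetter_mem_comap_selmerInfty_inf_away_iff`** — `Q` = {`y ∈ H¹(ℚ_∞, E[2])` |
  locally trivial at every ODD place-conjugate ∧ `ι_*(conj_σ y) ∈` the classical Kummer kernel above `2` ∧ `ev_w(conj_σ y) ∈ {O, T_w}`
  (the KUMMER LINE) at the real place-conjugates} and **`exists_kummerLetter_finite_twoTorsion_selmerInfty_iff`**: `Sel_{2^∞}(W/ℚ_∞)[2]`
  finite ⟺ that set is finite. So in `E[2]`-currency the ONLY condition of stub T not yet made explicit is the one ABOVE `2`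
  (classically `Im κ_𝔭`; expected: «unramified modulo the formal-group letter `Ê[2]`», Greenberg's ordinary condition — NOT proved here).

References: R. Greenberg, LNM 1716 (1999) §1 (Conj. 1.11), §2 (Prop. 2.1, (2) p. 72), §3, §4 (Lemma 4.6, p. 106); Lim–Sujatha, J. Number
Theory 187 (2018) §3; L. Washington, *Cyclotomic Fields* §13.2; crux workfiles `PERFECT-DESCENT.md`, `RELAXED-COEFFICIENTS-att-p5.md`.
-/

set_option autoImplicit false
-- the Theorems namespace of this sub repeats the summit name by design (D-0017 nested layout)
set_option linter.dupNamespace false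

noncomputable section

open scoped Classical

namespace Summit.BirchSwinnertonDyer.BirchSwinnertonDyer.Theorems.AlignedTransportAtTwoFineRoad.RealKummerClassical

open WeierstrassCurve NumberField IsDedekindDomain Field Literature.NumberTheory.EllipticCurves
  Literature.NumberTheory.EllipticCurves.GreenbergSelmer Literature.NumberTheory.GaloisRepresentations
  Literature.NumberTheory.EllipticCurves.FineSelmerCoefficientMap
  Summit.BirchSwinnertonDyer.BirchSwinnertonDyer.Theorems.AlignedTransportAtTwoFineRoad

/-! ## §1 Any number field, any prime, cyclotomic tower: the classes locally trivial away from `p` have finite index in `ι_*⁻¹(Sel_{p^∞}(E/K_∞))` -/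

section Generic

variable {K : Type} [Field K] [NumberField K] (W : WeierstrassCurve K) [W.IsElliptic] {p : ℕ} [Fact p.Prime]
  (κ : ZpExtension K p)

omit [NumberField K] in
/-- **`S[p]` finite ⟺ `ι_*⁻¹(S)` finite, for ANY subgroup `S ≤ H¹(H, E[p^∞])`** (any `H ≤ Γ_K`): `ι_*` has finite kernel
`E(K̄^H)[p^∞]/p` (`finite_ker_torsionToPrimaryH1Sub`) and hits every `p`-torsion class (`exists_torsionToPrimaryH1Sub_eq`). (att-p5 g9
proved the case `S = Sel₀(K_∞, E[p^∞])`; att-p3 g7 the case `S = Sel_{2^∞}(W/ℚ_∞)` under `E(ℚ)[2] = 0`.)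
[cite: GreenbergLNM1716, §3 (proof of Lemma 3.1) and §5 p. 114] -/
theorem finite_pTorsion_iff_finite_comap (H : Subgroup (absoluteGaloisGroup K)) (S : AddSubgroup (W.subgroupH1 p H)) :
    Set.Finite {s : S | p • s = 0} ↔
      Set.Finite ((S.comap (W.torsionToPrimaryH1Sub p H) : Set (subgroupH1 H ↥(W.geomTorsion (p : ℤ))))) := by
  set ι := W.torsionToPrimaryH1Sub p H with hι
  set T : Set (W.subgroupH1 p H) := {x | x ∈ S ∧ p • x = 0} with hT
  have hTeq : T = (fun s : S ↦ (s : W.subgroupH1 p H)) '' {s : S | p • s = 0} := by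
    ext x
    simp only [hT, Set.mem_setOf_eq, Set.mem_image]
    constructor
    · rintro ⟨hx, hpx⟩
      exact ⟨⟨x, hx⟩, Subtype.ext (by rw [AddSubgroupClass.coe_nsmul]; exact hpx), rfl⟩
    · rintro ⟨s, hs, rfl⟩
      exact ⟨s.2, by rw [← AddSubgroupClass.coe_nsmul, hs]; rfl⟩
  constructor
  · intro hfin
    have hTfin : T.Finite := by rw [hTeq]; exact hfin.image _
    have hker : ((ι.ker : AddSubgroup (subgroupH1 H (geomTorsion W (p : ℤ)))) :
        Set (subgroupH1 H (geomTorsion W (p : ℤ)))).Finite :=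
      W.finite_ker_torsionToPrimaryH1Sub p (H := H) W.zsmul_geomPoints_surjective_holds
    refine (AddMonoidHom.finite_preimage_of_finite_ker ι hker hTfin).subset fun y hy ↦ ?_
    exact ⟨hy, FineSelmerCoefficientMap.p_smul_torsionToPrimaryH1Sub_eq_zero W H y⟩
  · intro hfin
    have hsub : T ⊆ ι '' ((S.comap ι : AddSubgroup _) : Set (subgroupH1 H ↥(W.geomTorsion (p : ℤ)))) := by
      rintro x ⟨hx, hpx⟩
      obtain ⟨y, rfl⟩ := W.exists_torsionToPrimaryH1Sub_eq p W.zsmul_geomPoints_surjective_holds hpx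
      exact ⟨y, hx, rfl⟩
    have hTfin : T.Finite := (hfin.image ι).subset hsub
    rw [hTeq] at hTfin
    exact Set.Finite.of_finite_image hTfin Subtype.val_injective.injOn

/-- **Membership in `Q = ι_*⁻¹(Sel_{p^∞}(E/K_∞)) ⊓ A`.** `y ∈ Q` iff (i) for every finite `v ∤ p` and every `σ`, `conj_σ y` restricts to
ZERO on `H ⊓ D_v` (locally trivial — the honest `E[p]`-condition; it implies the classical one for `ι_*(conj_σ y)`, which over `K_∞`
is «locally trivial» too, att-p4 g3 `LocalAway.localKerOver_eq_awayKer`), (ii) for every `v ∣ p` and every `σ`, `ι_*(conj_σ y)` lies in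
the classical Kummer kernel above `v` (`localKerOver`, pulled back), (iii) likewise at every infinite place.
[cite: GreenbergLNM1716, §2 Prop. 2.1 and (2) (p. 72)] -/
theorem mem_comap_selmerInfty_inf_away_iff (y : subgroupH1 κ.kerSubgroup ↥(W.geomTorsion (p : ℤ))) :
    y ∈ (W.selmerInfty κ).comap (W.torsionToPrimaryH1Sub p κ.kerSubgroup) ⊓
        ⨅ (v : HeightOneSpectrum (𝓞 K)) (_ : ((p : ℕ) : 𝓞 K) ∉ v.asIdeal) (σ : absoluteGaloisGroup K),
          (awayKer κ.kerSubgroup ↥(W.geomTorsion (p : ℤ)) v).comap (conjH1 κ.kerSubgroup ↥(W.geomTorsion (p : ℤ)) σ) ↔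
      (∀ (v : HeightOneSpectrum (𝓞 K)), ((p : ℕ) : 𝓞 K) ∉ v.asIdeal → ∀ σ : absoluteGaloisGroup K,
          resOfLe (↥(W.geomTorsion (p : ℤ))) (inf_le_left : κ.kerSubgroup ⊓ decomp v ≤ κ.kerSubgroup)
            (conjH1 κ.kerSubgroup (↥(W.geomTorsion (p : ℤ))) σ y) = 0) ∧
        (∀ (v : HeightOneSpectrum (𝓞 K)), ((p : ℕ) : 𝓞 K) ∈ v.asIdeal → ∀ σ : absoluteGaloisGroup K,
          W.torsionToPrimaryH1Sub p κ.kerSubgroup (conjH1 κ.kerSubgroup (↥(W.geomTorsion (p : ℤ))) σ y) ∈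
            W.localKerOver p κ.kerSubgroup (v.adicCompletion K)) ∧
        ∀ (w : InfinitePlace K) (σ : absoluteGaloisGroup K),
          W.torsionToPrimaryH1Sub p κ.kerSubgroup (conjH1 κ.kerSubgroup (↥(W.geomTorsion (p : ℤ))) σ y) ∈
            W.localKerOver p κ.kerSubgroup w.Completion := by
  simp only [AddSubgroup.mem_inf, AddSubgroup.mem_iInf, AddSubgroup.mem_comap, WeierstrassCurve.selmerInfty,
    WeierstrassCurve.mem_selmerGroupOver_iff, WeierstrassCurve.conjH1_torsionToPrimaryH1Sub, awayKer, AddMonoidHom.mem_ker]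
  constructor
  · rintro ⟨⟨hfin, hinf⟩, haway⟩
    exact ⟨haway, fun v hv σ ↦ hfin v σ, hinf⟩
  · rintro ⟨haway, hp, hinf⟩
    refine ⟨⟨fun v σ ↦ ?_, hinf⟩, haway⟩
    by_cases hv : ((p : ℕ) : 𝓞 K) ∈ v.asIdeal
    · exact hp v hv σ
    · rw [LocalAway.localKerOver_eq_awayKer W κ v hv, awayKer, AddMonoidHom.mem_ker,
        ← WeierstrassCurve.conjH1_torsionToPrimaryH1Sub, WeierstrassCurve.conjH1_torsionToPrimaryH1Sub,
        resOfLe_torsionToPrimaryH1Sub, haway v hv σ, map_zero]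

/-- **`[P : Q] < ∞` for the CLASSICAL Selmer group**: inside `P = ι_*⁻¹(Sel_{p^∞}(E/K_∞))` the classes locally trivial at every
finite `v ∤ p` have FINITE INDEX (cyclotomic `ℤ_p`-extension of any number field, any `p`, any elliptic `E`). Proof: the signature
homomorphism `Ψ : y ↦ (res_{H ⊓ D_v}(conj_{τ_i} y))` over the finitely many BAD `v ∤ p` and `p^c` representatives `τ_i`
(`forall_resOfLe_conjH1_eq_zero_of_reps`) maps `P` into the finite set `∏ ker ι_{H ⊓ D_v}` (`finite_ker_torsionToPrimaryH1Sub`; the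
classical condition at `v ∤ p` over `K_∞` is «locally trivial», `LocalAway.localKerOver_eq_awayKer`), and `P ⊓ ker Ψ ≤ Q` (at good
`v ∤ p` the local kernel vanishes, `eq_zero_of_torsionToPrimaryH1Sub_eq_zero_of_hasGoodReductionAt`; the conditions above `p` and at
`∞` are identical on both sides). [cite: GreenbergLNM1716, §2 (2) (p. 72) and §3 (Lemmas 3.1–3.3)] [cite: LimSujatha2018, §3 (proof of Prop. 3.2)] -/
theorem relIndex_comap_selmerInfty_inf_away_ne_zero (hκ : κ.IsCyclotomic) :
    ((W.selmerInfty κ).comap (W.torsionToPrimaryH1Sub p κ.kerSubgroup) ⊓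
          ⨅ (v : HeightOneSpectrum (𝓞 K)) (_ : ((p : ℕ) : 𝓞 K) ∉ v.asIdeal) (σ : absoluteGaloisGroup K),
            (awayKer κ.kerSubgroup ↥(W.geomTorsion (p : ℤ)) v).comap
              (conjH1 κ.kerSubgroup ↥(W.geomTorsion (p : ℤ)) σ)).relIndex
        ((W.selmerInfty κ).comap (W.torsionToPrimaryH1Sub p κ.kerSubgroup)) ≠ 0 := by
  have hpr : p.Prime := Fact.out
  -- notation
  let H := κ.kerSubgroup
  let Mp : Type := ↥(W.geomTorsion (p : ℤ))
  let ι : subgroupH1 H Mp →+ W.subgroupH1 p H := W.torsionToPrimaryH1Sub p H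
  set P : AddSubgroup (subgroupH1 H Mp) := (W.selmerInfty κ).comap ι with hPdef
  set A : AddSubgroup (subgroupH1 H Mp) :=
    ⨅ (v : HeightOneSpectrum (𝓞 K)) (_ : ((p : ℕ) : 𝓞 K) ∉ v.asIdeal) (σ : absoluteGaloisGroup K),
      (awayKer H Mp v).comap (conjH1 H Mp σ) with hAdef
  have hAmem : ∀ x : subgroupH1 H Mp, x ∈ A ↔ ∀ (v : HeightOneSpectrum (𝓞 K)), ((p : ℕ) : 𝓞 K) ∉ v.asIdeal →
      ∀ σ : absoluteGaloisGroup K, resOfLe Mp (inf_le_left : H ⊓ decomp v ≤ H) (conjH1 H Mp σ x) = 0 := by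
    intro x
    simp only [hAdef, AddSubgroup.mem_iInf, AddSubgroup.mem_comap, awayKer, AddMonoidHom.mem_ker]
  have hPmem : ∀ x : subgroupH1 H Mp, x ∈ P → ∀ (v : HeightOneSpectrum (𝓞 K)), ((p : ℕ) : 𝓞 K) ∉ v.asIdeal →
      ∀ σ : absoluteGaloisGroup K, W.torsionToPrimaryH1Sub p (H ⊓ decomp v)
        (resOfLe Mp (inf_le_left : H ⊓ decomp v ≤ H) (conjH1 H Mp σ x)) = 0 := by
    intro x hx v hv σ
    have hx' : ι x ∈ W.selmerInfty κ := hx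
    have h := LocalAway.conjH1_mem_awayKer_of_mem_selmerInfty W κ hx' v hv σ
    rw [awayKer, AddMonoidHom.mem_ker, WeierstrassCurve.conjH1_torsionToPrimaryH1Sub, resOfLe_torsionToPrimaryH1Sub] at h
    exact h
  -- the finite set `S` of bad places prime to `p`
  have hSfin : ({v : HeightOneSpectrum (𝓞 K) | ((p : ℕ) : 𝓞 K) ∉ v.asIdeal} ∩ W.badPlaces (𝓞 K)).Finite :=
    (W.finite_badPlaces_holds (𝓞 K)).subset Set.inter_subset_right
  set S := hSfin.toFinset with hSdef
  have hSp : ∀ v ∈ S, ((p : ℕ) : 𝓞 K) ∉ v.asIdeal := fun v hv ↦ by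
    rw [hSdef, Set.Finite.mem_toFinset] at hv
    exact hv.1
  have hS : ∀ v ∉ S, ((p : ℕ) : 𝓞 K) ∉ v.asIdeal → W.HasGoodReductionAt v := by
    intro v hv hpv
    rw [hSdef, Set.Finite.mem_toFinset, Set.mem_inter_iff, not_and] at hv
    by_contra h
    exact hv hpv h
  -- representatives: a uniform `c` and the elements `τ i`
  have hreps := fun v : HeightOneSpectrum (𝓞 K) ↦
    forall_resOfLe_conjH1_eq_zero_of_reps (M := Mp) hκ v
  choose cv hcv using hreps
  let c : ℕ := S.sup cv
  have hτex : ∀ i : ℕ, ∃ τ : absoluteGaloisGroup K, κ τ = Multiplicative.ofAdd ((i : ℕ) : ℤ_[p]) :=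
    fun i ↦ κ.surjective _
  choose τ hτ using hτex
  -- the signature map `Ψ` (bad places prime to `p` only)
  let resv : ∀ v : HeightOneSpectrum (𝓞 K), subgroupH1 H Mp →+ subgroupH1 (H ⊓ decomp v) Mp := fun v ↦
    resOfLe Mp (inf_le_left : H ⊓ decomp v ≤ H)
  let Ψ : subgroupH1 H Mp →+ ((v : S) → Fin (p ^ c) → subgroupH1 (H ⊓ decomp (v : HeightOneSpectrum (𝓞 K))) Mp) :=
    { toFun := fun x v i ↦ resv v (conjH1 H Mp (τ i) x)
      map_zero' := by ext v i; simp
      map_add' := fun x y ↦ by ext v i; simp }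
  -- (a) values of `Ψ` on `P` lie in the finite local kernels
  have hΨker : ∀ x ∈ P, ∀ (v : S) (i : Fin (p ^ c)),
      Ψ x v i ∈ (W.torsionToPrimaryH1Sub p (H ⊓ decomp (v : HeightOneSpectrum (𝓞 K)))).ker := by
    intro x hx v i
    rw [AddMonoidHom.mem_ker]
    exact hPmem x hx v (hSp v v.2) (τ i)
  -- (b) a class of `P` killed by `Ψ` is locally trivial at every finite `v ∤ p`
  have hΨzero : ∀ x ∈ P, Ψ x = 0 → x ∈ A := by
    intro x hx hΨ
    rw [hAmem]
    intro v hpv σ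
    by_cases hvS : v ∈ S
    · -- representatives
      refine hcv v τ hτ x (fun i hi ↦ ?_) σ
      have hi' : i < p ^ c := lt_of_lt_of_le hi (Nat.pow_le_pow_right hpr.pos (Finset.le_sup hvS))
      have := congrFun (congrFun hΨ ⟨v, hvS⟩) ⟨i, hi'⟩
      exact this
    · -- good place `v ∤ p`: the local kernel vanishes
      exact eq_zero_of_torsionToPrimaryH1Sub_eq_zero_of_hasGoodReductionAt W κ hκ hpv (hS v hvS hpv) _
        (hPmem x hx v hpv σ)
  -- (c) `Ψ(P)` is finite, so `ker Ψ` has finite index in `P`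
  have hmapfin : ((P.map Ψ : AddSubgroup _) : Set ((v : S) → Fin (p ^ c) →
      subgroupH1 (H ⊓ decomp (v : HeightOneSpectrum (𝓞 K))) Mp)).Finite := by
    let T : Set ((v : S) → Fin (p ^ c) → subgroupH1 (H ⊓ decomp (v : HeightOneSpectrum (𝓞 K))) Mp) :=
      Set.pi Set.univ fun v ↦ Set.pi Set.univ fun _ ↦
        ((W.torsionToPrimaryH1Sub p (H ⊓ decomp (v : HeightOneSpectrum (𝓞 K)))).ker : Set _)
    have hTfin : T.Finite := by
      refine Set.Finite.pi fun v ↦ Set.Finite.pi fun _ ↦ ?_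
      exact W.finite_ker_torsionToPrimaryH1Sub p (H := H ⊓ decomp (v : HeightOneSpectrum (𝓞 K)))
        W.zsmul_geomPoints_surjective_holds
    refine hTfin.subset ?_
    rintro _ ⟨x, hx, rfl⟩
    simp only [T, Set.mem_univ_pi]
    intro v i
    exact hΨker x hx v i
  have hkerIdx : Ψ.ker.relIndex P ≠ 0 := by
    rw [AddSubgroup.relIndex_ker]
    haveI : Finite (P.map Ψ) := hmapfin.to_subtype
    exact Nat.card_ne_zero.mpr ⟨⟨0⟩, inferInstance⟩
  -- (d) `P ⊓ ker Ψ ≤ Q`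
  have hle : Ψ.ker ⊓ P ≤ P ⊓ A := fun x hx ↦
    ⟨hx.2, hΨzero x hx.2 ((AddMonoidHom.mem_ker).mp hx.1)⟩
  intro h0
  apply hkerIdx
  rw [← AddSubgroup.inf_relIndex_right]
  exact AddSubgroup.relIndex_eq_zero_of_le_left hle h0

/-- **`P` finite ⟺ `Q` finite** (`P = ι_*⁻¹(Sel_{p^∞}(E/K_∞))`, `Q = P ⊓ A`; cyclotomic `κ`, any `K`, any `p`): finite index.
[cite: GreenbergLNM1716, §2 (2) and §3] [cite: LimSujatha2018, §3 (proof of Prop. 3.2)] -/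
theorem finite_comap_selmerInfty_iff_finite_comap_inf_away (hκ : κ.IsCyclotomic) :
    Set.Finite ((W.selmerInfty κ).comap (W.torsionToPrimaryH1Sub p κ.kerSubgroup) :
        Set (subgroupH1 κ.kerSubgroup ↥(W.geomTorsion (p : ℤ)))) ↔
      Set.Finite (↑((W.selmerInfty κ).comap (W.torsionToPrimaryH1Sub p κ.kerSubgroup) ⊓
          ⨅ (v : HeightOneSpectrum (𝓞 K)) (_ : ((p : ℕ) : 𝓞 K) ∉ v.asIdeal) (σ : absoluteGaloisGroup K),
            (awayKer κ.kerSubgroup ↥(W.geomTorsion (p : ℤ)) v).comap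
              (conjH1 κ.kerSubgroup ↥(W.geomTorsion (p : ℤ)) σ)) :
        Set (subgroupH1 κ.kerSubgroup ↥(W.geomTorsion (p : ℤ)))) := by
  set P : AddSubgroup (subgroupH1 κ.kerSubgroup ↥(W.geomTorsion (p : ℤ))) :=
    (W.selmerInfty κ).comap (W.torsionToPrimaryH1Sub p κ.kerSubgroup) with hPdef
  set A : AddSubgroup (subgroupH1 κ.kerSubgroup ↥(W.geomTorsion (p : ℤ))) :=
    ⨅ (v : HeightOneSpectrum (𝓞 K)) (_ : ((p : ℕ) : 𝓞 K) ∉ v.asIdeal) (σ : absoluteGaloisGroup K),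
      (awayKer κ.kerSubgroup ↥(W.geomTorsion (p : ℤ)) v).comap
        (conjH1 κ.kerSubgroup ↥(W.geomTorsion (p : ℤ)) σ) with hAdef
  refine ⟨fun h ↦ h.subset fun x hx ↦ hx.1, fun h ↦ ?_⟩
  have hidx : (P ⊓ A).relIndex P ≠ 0 := relIndex_comap_selmerInfty_inf_away_ne_zero W κ hκ
  haveI hQfin : Finite ↥(P ⊓ A) := h.to_subtype
  haveI : Finite ((P ⊓ A).addSubgroupOf P) :=
    Finite.of_equiv _ (AddSubgroup.addSubgroupOfEquivOfLe (inf_le_left : P ⊓ A ≤ P)).toEquiv.symm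
  have hcard := AddSubgroup.card_mul_index ((P ⊓ A).addSubgroupOf P)
  have hne : Nat.card ((P ⊓ A).addSubgroupOf P) ≠ 0 := Nat.card_ne_zero.mpr ⟨⟨0⟩, inferInstance⟩
  have hP : Nat.card P ≠ 0 := by
    rw [← hcard]
    exact mul_ne_zero hne hidx
  exact Set.finite_coe_iff.mp (Nat.finite_of_card_ne_zero hP)

/-- **`Sel_{p^∞}(E/K_∞)[p]` finite ⟺ `Q` finite** — the `p`-DESCENT form of «`X(E/K_∞)` is `Λ`-torsion with `μ = 0`» with the honest
`E[p]`-condition «locally trivial» at every finite place prime to `p` (cyclotomic `ℤ_p`-extension of any number field, any `p`, any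
elliptic `E`). [cite: GreenbergLNM1716, §1 p. 60, §2 (2), §3] [cite: LimSujatha2018, §3] -/
theorem finite_pTorsion_selmerInfty_iff_finite_comap_inf_away (hκ : κ.IsCyclotomic) :
    Set.Finite {s : W.selmerInfty κ | p • s = 0} ↔
      Set.Finite (↑((W.selmerInfty κ).comap (W.torsionToPrimaryH1Sub p κ.kerSubgroup) ⊓
          ⨅ (v : HeightOneSpectrum (𝓞 K)) (_ : ((p : ℕ) : 𝓞 K) ∉ v.asIdeal) (σ : absoluteGaloisGroup K),
            (awayKer κ.kerSubgroup ↥(W.geomTorsion (p : ℤ)) v).comap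
              (conjH1 κ.kerSubgroup ↥(W.geomTorsion (p : ℤ)) σ)) :
        Set (subgroupH1 κ.kerSubgroup ↥(W.geomTorsion (p : ℤ)))) :=
  (finite_pTorsion_iff_finite_comap W κ.kerSubgroup (W.selmerInfty κ)).trans
    (finite_comap_selmerInfty_iff_finite_comap_inf_away W κ hκ)

/-- **`X(E/K_∞)` torsion with `μ = 0` (for one / every dual datum) ⟺ `Q` finite** — stub T's CONCLUSION in `p`-descent currency
(att-p3 g7 `SeedTwoTorsion.finite_pTorsion_iff_isTorsion_and_mu_eq_zero` + the above). [cite: GreenbergLNM1716, §1 Conj. 1.11 and p. 60]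
[cite: Washington1997, §13.2] -/
theorem isTorsion_and_mu_eq_zero_iff_finite_comap_inf_away (hκ : κ.IsCyclotomic) {γ : absoluteGaloisGroup K}
    (hγ : κ.IsTopGenerator γ) (D : W.SelmerDualData κ γ) :
    (D.IsTorsion ∧ D.mu = 0) ↔
      Set.Finite (↑((W.selmerInfty κ).comap (W.torsionToPrimaryH1Sub p κ.kerSubgroup) ⊓
          ⨅ (v : HeightOneSpectrum (𝓞 K)) (_ : ((p : ℕ) : 𝓞 K) ∉ v.asIdeal) (σ : absoluteGaloisGroup K),
            (awayKer κ.kerSubgroup ↥(W.geomTorsion (p : ℤ)) v).comap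
              (conjH1 κ.kerSubgroup ↥(W.geomTorsion (p : ℤ)) σ)) :
        Set (subgroupH1 κ.kerSubgroup ↥(W.geomTorsion (p : ℤ)))) :=
  (AlignedTransportAtTwoSeedTwoTorsion.finite_pTorsion_iff_isTorsion_and_mu_eq_zero W κ hγ D).symm.trans
    (finite_pTorsion_selmerInfty_iff_finite_comap_inf_away W κ hκ)

end Generic

/-! ## §2 `E/ℚ`, `p = 2`, `Δ_E > 0`: locally trivial at the ODD places, Kummer above `2` (pulled back), Kummer LINE at `∞` -/

section RatTwo

variable (W : WeierstrassCurve ℚ) [W.IsElliptic] (κ : ZpExtension ℚ 2)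

/-- **`Q` for the classical Selmer group over `ℚ_∞`, `Δ_E > 0`.** With a non-trivial `g ∈ ker κ ⊓ D_w` fixing `E[2]` (cyclotomic `κ`):
`y ∈ Q` iff (i) `conj_σ y` restricts to zero on `ker κ ⊓ D_v` for every ODD `v` and every `σ`, (ii) `ι_*(conj_σ y)` lies in the classical
Kummer kernel above `2` for every `σ`, (iii) `ev_w(conj_σ y) ∈ {O, T_w}` for every `σ` — at the real place the classical Kummer
condition (`localKerOver`, = `infKer` on `E[2^∞]`, att-p4 g3 `LocalArch.localKerOver_two_eq_infKer`) pulls back to the KUMMER LINE of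
att-p5 g9 (`RealKummerLine`). [cite: GreenbergLNM1716, §2 (2) and §4 Lemma 4.6 (p. 106)] [cite: SilvermanAEC2009, X.1 (Prop. 1.4)] -/
theorem exists_kummerLetter_mem_comap_selmerInfty_inf_away_iff (hΔ : 0 < W.Δ) (w : InfinitePlace ℚ)
    (htriv : ∀ (g : ↥(κ.kerSubgroup ⊓ decompInf w)) (m : ↥(W.geomTorsion 2)), g • m = m)
    {g : ↥(κ.kerSubgroup ⊓ decompInf w)} (hg : g ≠ 1) :
    ∃ Tw : ↥(W.geomTorsion 2), Tw ≠ 0 ∧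
      (∀ t : ↥(W.geomTorsion 2),
        (∃ a : ↥(W.geomPrimaryTorsion 2), (g : absoluteGaloisGroup ℚ) • a - a =
            AddSubgroup.inclusion (geomTorsion_le_geomPrimaryTorsion W 2) t) ↔ (t = 0 ∨ t = Tw)) ∧
      ∀ y : subgroupH1 κ.kerSubgroup ↥(W.geomTorsion 2),
        y ∈ (W.selmerInfty κ).comap (W.torsionToPrimaryH1Sub 2 κ.kerSubgroup) ⊓
            ⨅ (v : HeightOneSpectrum (𝓞 ℚ)) (_ : ((2 : ℕ) : 𝓞 ℚ) ∉ v.asIdeal) (σ : absoluteGaloisGroup ℚ),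
              (awayKer κ.kerSubgroup ↥(W.geomTorsion 2) v).comap (conjH1 κ.kerSubgroup ↥(W.geomTorsion 2) σ) ↔
          (∀ (v : HeightOneSpectrum (𝓞 ℚ)), ((2 : ℕ) : 𝓞 ℚ) ∉ v.asIdeal → ∀ σ : absoluteGaloisGroup ℚ,
              resOfLe (↥(W.geomTorsion 2)) (inf_le_left : κ.kerSubgroup ⊓ decomp v ≤ κ.kerSubgroup)
                (conjH1 κ.kerSubgroup (↥(W.geomTorsion 2)) σ y) = 0) ∧
            (∀ (v : HeightOneSpectrum (𝓞 ℚ)), ((2 : ℕ) : 𝓞 ℚ) ∈ v.asIdeal → ∀ σ : absoluteGaloisGroup ℚ,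
              W.torsionToPrimaryH1Sub 2 κ.kerSubgroup (conjH1 κ.kerSubgroup (↥(W.geomTorsion 2)) σ y) ∈
                W.localKerOver 2 κ.kerSubgroup (v.adicCompletion ℚ)) ∧
            ∀ σ : absoluteGaloisGroup ℚ,
              evalH1 htriv g (resOfLe (↥(W.geomTorsion 2)) (inf_le_left : κ.kerSubgroup ⊓ decompInf w ≤ κ.kerSubgroup)
                  (conjH1 κ.kerSubgroup (↥(W.geomTorsion 2)) σ y)) = 0 ∨
                evalH1 htriv g (resOfLe (↥(W.geomTorsion 2)) (inf_le_left : κ.kerSubgroup ⊓ decompInf w ≤ κ.kerSubgroup)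
                  (conjH1 κ.kerSubgroup (↥(W.geomTorsion 2)) σ y)) = Tw := by
  obtain ⟨Tw, hTw0, hline, hiff⟩ :=
    RealKummerLine.exists_kummerLetter_torsionToPrimaryH1Sub_mem_infKer_iff W κ.kerSubgroup w hΔ htriv hg
  refine ⟨Tw, hTw0, hline, fun y ↦ ?_⟩
  have hmem := mem_comap_selmerInfty_inf_away_iff W κ (p := 2) y
  refine hmem.trans (and_congr Iff.rfl (and_congr Iff.rfl ⟨fun h σ ↦ ?_, fun h w' σ ↦ ?_⟩))
  · have h1 := h w σ
    rw [LocalArch.localKerOver_two_eq_infKer] at h1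
    exact (hiff _).mp h1
  · rw [Subsingleton.elim w' w, LocalArch.localKerOver_two_eq_infKer]
    exact (hiff _).mpr (h σ)

/-- **`Sel_{2^∞}(W/ℚ_∞)[2]` finite — i.e. `X(W/ℚ_∞)` `Λ`-torsion with `μ₂ = 0`, the conclusion of stub T — ⟺ finiteness of the set of
`E[2]`-classes over `ℚ_∞` that are LOCALLY TRIVIAL at every odd place-conjugate, satisfy the classical Kummer condition above `2`
(pulled back along `ι_*`) and lie on the KUMMER LINE `{O, T_w}` at every real place-conjugate** (`Δ_E > 0`, cyclotomic `ℤ₂`-extension;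
`g`, `htriv` supplied by `RealKummerSelmer.exists_ne_one_and_smul_eq_self`). The only local condition of T not yet explicit on `E[2]`
is the one ABOVE `2`. [cite: GreenbergLNM1716, §1 Conj. 1.11, §2 (2), §4 Lemma 4.6] [cite: Washington1997, §13.2] -/
theorem exists_kummerLetter_finite_twoTorsion_selmerInfty_iff (hκ : κ.IsCyclotomic) (hΔ : 0 < W.Δ) (w : InfinitePlace ℚ)
    (htriv : ∀ (g : ↥(κ.kerSubgroup ⊓ decompInf w)) (m : ↥(W.geomTorsion 2)), g • m = m)
    {g : ↥(κ.kerSubgroup ⊓ decompInf w)} (hg : g ≠ 1) :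
    ∃ Tw : ↥(W.geomTorsion 2), Tw ≠ 0 ∧
      (∀ t : ↥(W.geomTorsion 2),
        (∃ a : ↥(W.geomPrimaryTorsion 2), (g : absoluteGaloisGroup ℚ) • a - a =
            AddSubgroup.inclusion (geomTorsion_le_geomPrimaryTorsion W 2) t) ↔ (t = 0 ∨ t = Tw)) ∧
      (Set.Finite {s : W.selmerInfty κ | 2 • s = 0} ↔
        Set.Finite {y : subgroupH1 κ.kerSubgroup ↥(W.geomTorsion 2) |
          (∀ (v : HeightOneSpectrum (𝓞 ℚ)), ((2 : ℕ) : 𝓞 ℚ) ∉ v.asIdeal → ∀ σ : absoluteGaloisGroup ℚ,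
              resOfLe (↥(W.geomTorsion 2)) (inf_le_left : κ.kerSubgroup ⊓ decomp v ≤ κ.kerSubgroup)
                (conjH1 κ.kerSubgroup (↥(W.geomTorsion 2)) σ y) = 0) ∧
            (∀ (v : HeightOneSpectrum (𝓞 ℚ)), ((2 : ℕ) : 𝓞 ℚ) ∈ v.asIdeal → ∀ σ : absoluteGaloisGroup ℚ,
              W.torsionToPrimaryH1Sub 2 κ.kerSubgroup (conjH1 κ.kerSubgroup (↥(W.geomTorsion 2)) σ y) ∈
                W.localKerOver 2 κ.kerSubgroup (v.adicCompletion ℚ)) ∧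
            ∀ σ : absoluteGaloisGroup ℚ,
              evalH1 htriv g (resOfLe (↥(W.geomTorsion 2)) (inf_le_left : κ.kerSubgroup ⊓ decompInf w ≤ κ.kerSubgroup)
                  (conjH1 κ.kerSubgroup (↥(W.geomTorsion 2)) σ y)) = 0 ∨
                evalH1 htriv g (resOfLe (↥(W.geomTorsion 2)) (inf_le_left : κ.kerSubgroup ⊓ decompInf w ≤ κ.kerSubgroup)
                  (conjH1 κ.kerSubgroup (↥(W.geomTorsion 2)) σ y)) = Tw}) := by
  obtain ⟨Tw, hTw0, hline, hiff⟩ := exists_kummerLetter_mem_comap_selmerInfty_inf_away_iff W κ hΔ w htriv hg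
  refine ⟨Tw, hTw0, hline, ?_⟩
  have hA := finite_pTorsion_selmerInfty_iff_finite_comap_inf_away W κ hκ (p := 2)
  exact hA.trans (iff_of_eq (congrArg Set.Finite (Set.ext fun y ↦ hiff y)))

end RatTwo

end Summit.BirchSwinnertonDyer.BirchSwinnertonDyer.Theorems.AlignedTransportAtTwoFineRoad.RealKummerClassical

end
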